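import Summits.AtomisticToContinuum.Crystallization.Theses.GappedShellCensus
import Literature.Probability.Process.LocalRubberCompact
import Literature.MathematicalPhysics.StatisticalMechanics.LocalMatchingCompactness

/-!
# Crux `GappedShellCensus.CleanLimitExtractionR` (stmt-AtomisticToContinuum-18072) — THE BRIDGE
# `RadialDefectsVanish → ShellTrichotomy → TornFree → FiveFoldRationingR → CleanLocalLimit`

Line `CleanLimitExtractionR_CandidateProof` (crux-ideate ideator 2's complete candidate, tree copy
`Cruxes/CleanLimitExtractionR/SketchIdeator2.lean`), ported to `Theorems/` as six stubs and this
composition: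

* stub E `stub_cleRGoodBall` — ball counting with the hard core (good balls of every radius,
  frequently, from a vanishing density of bad particles);
* stub A `stub_cleRGappedOfTendsto` — gapped-twelve is closed under local-rubber limits of
  `δ`-separated configurations (collar transfer through the Hales gap);
* stub B `stub_cleRFccHcpOfTendsto` — the `1/5`-fcc/hcp typing of rescaled shells is closed under
  the same limits (stage labelling, pigeonhole, compactness of `O(3)`);
* stub C₁ `stub_cleRCleanHullElement` — E → A → B → pattern-typed rationing → radial defects vanish
  at scale `a` → a rooted, everywhere-clean member of the ω-limit hull of `x` (compact rubber space
  `LocalConfig ℝ³`, two extractions);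
* stub C₂ `stub_cleRHullDictionary` — hull membership ⇒ the matching clause of `CleanLocalLimit`;
* stub D `stub_cleRTrichotomyFactor` — `ShellTrichotomy → TornFree → FiveFoldRationingR →`
  pattern-typed rationing (the bookkeeping identity shell-degree = common-neighbour count turns
  TornFree's `≥ 4` and FiveFoldRationingR's `≤ 4` into "neither capped nor torn", so the trichotomy
  yields branch (A) on balls of every radius).
-/

noncomputable section

namespace Summit.AtomisticToContinuum.Crystallization.Theorems

open Filter Topology Set
open scoped Classical
open Literature.Probability.Process Literature.MathematicalPhysics.StatisticalMechanics
  Literature.Geometry.DiscreteGeometry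
open Summit.AtomisticToContinuum.Crystallization.Theses.GappedShellCensus

variable {x : (N : ℕ) → (Fin N → EuclideanSpace ℝ (Fin 3))} {Y : LocalConfig (EuclideanSpace ℝ (Fin 3))}

/-! ## Registered stubs (each proved in its own helper file `Theorems/GappedShellCensusCleanLimitExtractionRStub*.lean`) -/

/-- **Stub E — THE COUNTING STEP** (ball counting with the hard core): for `δ`-separated finite
configurations `x N`, if the bad particles number at most `θN` frequently for every `θ > 0`, then
for every radius `k ≥ 0`, frequently some particle has only good particles within `k` — otherwise
every particle lies within `k` of a bad one, and the shadows of bad particles have at most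
`(2k/δ + 1)³` members each (`card_le_of_separated_of_dist_le`), so `N ≤ #bad · (2k/δ+1)³ ≤ N/2`. -/
theorem stub_cleRGoodBall {x : (N : ℕ) → (Fin N → EuclideanSpace ℝ (Fin 3))} {δ : ℝ} (hδ : 0 < δ)
    (hsep : ∀ N (i j : Fin N), i ≠ j → δ ≤ dist (x N i) (x N j))
    (good : (N : ℕ) → Fin N → Prop)
    (hRDV : ∀ θ : ℝ, 0 < θ → ∃ᶠ N in atTop, (Nat.card {i : Fin N // ¬ good N i} : ℝ) ≤ θ * N)
    (k : ℝ) (hk : 0 ≤ k) :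
    ∃ᶠ N in atTop, ∃ i : Fin N, ∀ j : Fin N, dist (x N j) (x N i) ≤ k → good N j := by
  sorry

/-- **Stub A — GAPPED-TWELVE IS CLOSED under local-rubber limits** of `δ`-separated
configurations (sitewise, with radius loss): if `S k → Y` in `LocalConfig ℝ³`, all `S k` are
`δ`-separated, `y ∈ Y`, `‖y‖ < r`, and eventually every site of `S k` in `B̄(0, r)` is gapped-twelve
at scale `a > 0` (twelve other points in the closed bond shell `dist ≤ 1.02 a`, none closer than
`0.98 a`, none in the open annulus `(1.02 a, 1.26 a)`), then `y` is gapped-twelve at scale `a` in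
`Y` — `cleR_radial_of_tendsto` plus `cleR_gappedTwelve_transfer` applied to one fine matching
(`LocalConfig.tendsto_iff_locallyMatches`). -/
theorem stub_cleRGappedOfTendsto {S : ℕ → LocalConfig (EuclideanSpace ℝ (Fin 3))} {Y : LocalConfig (EuclideanSpace ℝ (Fin 3))} {a δ : ℝ}
    (ha : 0 < a) (hδ : 0 < δ) (hS : ∀ k, ∀ u ∈ S k, ∀ v ∈ S k, u ≠ v → δ ≤ dist u v)
    (hY : Tendsto S atTop (𝓝 Y)) {y : EuclideanSpace ℝ (Fin 3)} {r : ℝ} (hy : y ∈ Y) (hyr : ‖y‖ < r)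
    (hgood : ∀ᶠ k in atTop, ∀ p ∈ S k, ‖p‖ ≤ r → ({w ∈ (S k : Set (EuclideanSpace ℝ (Fin 3))) | w ≠ p ∧ dist p w ≤ a * (1 + 1 / 50)}.ncard = 12 ∧
          ∀ w ∈ (S k : Set (EuclideanSpace ℝ (Fin 3))), w ≠ p → a * (1 - 1 / 50) ≤ dist p w ∧
            (dist p w ≤ a * (1 + 1 / 50) ∨ a * (63 / 50) ≤ dist p w))) :
    ({w ∈ (Y : Set (EuclideanSpace ℝ (Fin 3))) | w ≠ y ∧ dist y w ≤ a * (1 + 1 / 50)}.ncard = 12 ∧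
          ∀ w ∈ (Y : Set (EuclideanSpace ℝ (Fin 3))), w ≠ y → a * (1 - 1 / 50) ≤ dist y w ∧
            (dist y w ≤ a * (1 + 1 / 50) ∨ a * (63 / 50) ≤ dist y w)) := by
  sorry

/-- **Stub B — THE fcc/hcp TYPING IS CLOSED under local-rubber limits** of `δ`-separated
configurations (sitewise, with radius loss): if eventually every site of `S k` in `B̄(0, r)` is
CLEAN (gapped-twelve with `1/5`-fcc/hcp-close rescaled shell), `S k → Y`, `y ∈ Y`, `‖y‖ < r`, and
`y` is already known to be gapped-twelve in `Y` (stub A), then the rescaled shell of `y` in `Y` is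
`1/5`-close to fcc or hcp.  The twelve shell points converge (collar transfer gives the
bijections, `cleR_stage_labelling`), one of the finitely many labellings `pattern → shell` recurs
(pigeonhole), the isometries converge along a subsequence (compactness of `O(3)`), and `≤ 1/5`
passes to the limit (`cleR_shellCloseTo_of_frequently`). -/
theorem stub_cleRFccHcpOfTendsto {S : ℕ → LocalConfig (EuclideanSpace ℝ (Fin 3))} {Y : LocalConfig (EuclideanSpace ℝ (Fin 3))} {a δ : ℝ}
    (ha : 0 < a) (hδ : 0 < δ) (hS : ∀ k, ∀ u ∈ S k, ∀ v ∈ S k, u ≠ v → δ ≤ dist u v)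
    (hY : Tendsto S atTop (𝓝 Y)) {y : EuclideanSpace ℝ (Fin 3)} {r : ℝ} (hy : y ∈ Y) (hyr : ‖y‖ < r)
    (hgood : ∀ᶠ k in atTop, ∀ p ∈ S k, ‖p‖ ≤ r →
      (({w ∈ (S k : Set (EuclideanSpace ℝ (Fin 3))) | w ≠ p ∧ dist p w ≤ a * (1 + 1 / 50)}.ncard = 12 ∧
            ∀ w ∈ (S k : Set (EuclideanSpace ℝ (Fin 3))), w ≠ p → a * (1 - 1 / 50) ≤ dist p w ∧
              (dist p w ≤ a * (1 + 1 / 50) ∨ a * (63 / 50) ≤ dist p w)) ∧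
          (∃ T : Finset (EuclideanSpace ℝ (Fin 3)), (↑T : Set (EuclideanSpace ℝ (Fin 3))) =
              (fun w => a⁻¹ • (w - p)) '' {w ∈ (S k : Set (EuclideanSpace ℝ (Fin 3))) | w ≠ p ∧ dist p w ≤ a * (1 + 1 / 50)} ∧
            (ShellCloseTo (1 / 5) T fccKissingPattern ∨ ShellCloseTo (1 / 5) T hcpKissingPattern))))
    (hGY : ({w ∈ (Y : Set (EuclideanSpace ℝ (Fin 3))) | w ≠ y ∧ dist y w ≤ a * (1 + 1 / 50)}.ncard = 12 ∧
          ∀ w ∈ (Y : Set (EuclideanSpace ℝ (Fin 3))), w ≠ y → a * (1 - 1 / 50) ≤ dist y w ∧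
            (dist y w ≤ a * (1 + 1 / 50) ∨ a * (63 / 50) ≤ dist y w))) :
    (∃ T : Finset (EuclideanSpace ℝ (Fin 3)), (↑T : Set (EuclideanSpace ℝ (Fin 3))) =
            (fun w => a⁻¹ • (w - y)) '' {w ∈ (Y : Set (EuclideanSpace ℝ (Fin 3))) | w ≠ y ∧ dist y w ≤ a * (1 + 1 / 50)} ∧
          (ShellCloseTo (1 / 5) T fccKissingPattern ∨ ShellCloseTo (1 / 5) T hcpKissingPattern)) := by
  sorry

/-- **Stub C₂ — THE HULL DICTIONARY**: a member `Y` of the hull of `x` (the ω-limit, as `N → ∞`, of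
all re-rootings `⟨range (x N)⟩.translate t` in the compact rubber space `LocalConfig ℝ³`) satisfies
the matching clause of `CleanLocalLimit`: along a strictly increasing subsequence `φ` and
translations `t n`, the translated clusters `x (φ n) · + t n` and `Y` are two-way `ε`-matched on
`B̄(0, R)` eventually, for all `R` and all `ε > 0`. -/
theorem stub_cleRHullDictionary (hY : Y ∈ omegaLimit atTop
      (fun N (t : EuclideanSpace ℝ (Fin 3)) => (⟨Set.range (x N)⟩ : LocalConfig (EuclideanSpace ℝ (Fin 3))).translate t) Set.univ) :
    ∃ (φ : ℕ → ℕ) (t : ℕ → EuclideanSpace ℝ (Fin 3)), StrictMono φ ∧ ∀ R ε : ℝ, 0 < ε → ∀ᶠ n in atTop,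
      (∀ y ∈ (Y : Set (EuclideanSpace ℝ (Fin 3))), ‖y‖ ≤ R → ∃ i : Fin (φ n), dist (x (φ n) i + t n) y ≤ ε) ∧
      (∀ i : Fin (φ n), ‖x (φ n) i + t n‖ ≤ R →
        ∃ y ∈ (Y : Set (EuclideanSpace ℝ (Fin 3))), dist (x (φ n) i + t n) y ≤ ε) := by
  sorry

/-- **Stub C₁ — THE ROOTED CLEAN HULL ELEMENT**: from the radial statement AT ONE SCALE `a` (the
clause of `RadialDefectsVanish`), ball counting (stub E), the two closedness statements (stubs A, B)
and the pattern-typed rationing (stub D's output: an all-gapped-twelve non-empty configuration has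
fcc/hcp-clean balls of every radius), a ROOTED member of the hull of `x` every site of which is
CLEAN at scale `a` (gapped-twelve with `1/5`-fcc/hcp-close rescaled shell).  Counting ⇒ rooted
re-rootings gapped on `B(0,k)`; `CompactSpace (LocalConfig ℝ³)` ⇒ limit `Y₀ ∈ hull`, all
gapped-twelve by closedness A; rationing ⇒ `Y₀.translate c_R ∈ hull` clean on `B(0,R)`; second
`tendsto_subseq`, limit in the CLOSED hull, clean everywhere by closedness A and B. -/
theorem stub_cleRCleanHullElement (x : (N : ℕ) → (Fin N → EuclideanSpace ℝ (Fin 3)))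
    (hx : ∀ N, IsGroundState lennardJones (x N)) {a : ℝ} (ha : 0 < a)
    (hRDVa : ∀ θ : ℝ, 0 < θ → ∃ᶠ N in atTop,
      (Nat.card {i : Fin N // ¬ ((Finset.univ.filter fun j : Fin N =>
          j ≠ i ∧ dist (x N i) (x N j) ≤ a * (1 + 1 / 50)).card = 12 ∧
        ∀ j : Fin N, j ≠ i → a * (1 - 1 / 50) ≤ dist (x N i) (x N j) ∧
          (dist (x N i) (x N j) ≤ a * (1 + 1 / 50) ∨ a * (63 / 50) ≤ dist (x N i) (x N j)))} : ℝ)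
        ≤ θ * N)
    (hE : ∀ (x : (N : ℕ) → (Fin N → EuclideanSpace ℝ (Fin 3))) (δ : ℝ), 0 < δ →
      (∀ N (i j : Fin N), i ≠ j → δ ≤ dist (x N i) (x N j)) → ∀ good : (N : ℕ) → Fin N → Prop,
      (∀ θ : ℝ, 0 < θ → ∃ᶠ N in atTop, (Nat.card {i : Fin N // ¬ good N i} : ℝ) ≤ θ * N) →
      ∀ k : ℝ, 0 ≤ k → ∃ᶠ N in atTop, ∃ i : Fin N, ∀ j : Fin N, dist (x N j) (x N i) ≤ k → good N j)
    (hA : ∀ (S : ℕ → LocalConfig (EuclideanSpace ℝ (Fin 3))) (Y : LocalConfig (EuclideanSpace ℝ (Fin 3))) (a δ : ℝ), 0 < a → 0 < δ →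
      (∀ k, ∀ u ∈ S k, ∀ v ∈ S k, u ≠ v → δ ≤ dist u v) → Tendsto S atTop (𝓝 Y) →
      ∀ (y : EuclideanSpace ℝ (Fin 3)) (r : ℝ), y ∈ Y → ‖y‖ < r →
      (∀ᶠ k in atTop, ∀ p ∈ S k, ‖p‖ ≤ r → ({w ∈ (S k : Set (EuclideanSpace ℝ (Fin 3))) | w ≠ p ∧ dist p w ≤ a * (1 + 1 / 50)}.ncard = 12 ∧
            ∀ w ∈ (S k : Set (EuclideanSpace ℝ (Fin 3))), w ≠ p → a * (1 - 1 / 50) ≤ dist p w ∧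
              (dist p w ≤ a * (1 + 1 / 50) ∨ a * (63 / 50) ≤ dist p w))) →
      ({w ∈ (Y : Set (EuclideanSpace ℝ (Fin 3))) | w ≠ y ∧ dist y w ≤ a * (1 + 1 / 50)}.ncard = 12 ∧
            ∀ w ∈ (Y : Set (EuclideanSpace ℝ (Fin 3))), w ≠ y → a * (1 - 1 / 50) ≤ dist y w ∧
              (dist y w ≤ a * (1 + 1 / 50) ∨ a * (63 / 50) ≤ dist y w)))
    (hB : ∀ (S : ℕ → LocalConfig (EuclideanSpace ℝ (Fin 3))) (Y : LocalConfig (EuclideanSpace ℝ (Fin 3))) (a δ : ℝ), 0 < a → 0 < δ →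
      (∀ k, ∀ u ∈ S k, ∀ v ∈ S k, u ≠ v → δ ≤ dist u v) → Tendsto S atTop (𝓝 Y) →
      ∀ (y : EuclideanSpace ℝ (Fin 3)) (r : ℝ), y ∈ Y → ‖y‖ < r →
      (∀ᶠ k in atTop, ∀ p ∈ S k, ‖p‖ ≤ r → (({w ∈ (S k : Set (EuclideanSpace ℝ (Fin 3))) | w ≠ p ∧ dist p w ≤ a * (1 + 1 / 50)}.ncard = 12 ∧
            ∀ w ∈ (S k : Set (EuclideanSpace ℝ (Fin 3))), w ≠ p → a * (1 - 1 / 50) ≤ dist p w ∧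
              (dist p w ≤ a * (1 + 1 / 50) ∨ a * (63 / 50) ≤ dist p w)) ∧
          (∃ T : Finset (EuclideanSpace ℝ (Fin 3)), (↑T : Set (EuclideanSpace ℝ (Fin 3))) =
              (fun w => a⁻¹ • (w - p)) '' {w ∈ (S k : Set (EuclideanSpace ℝ (Fin 3))) | w ≠ p ∧ dist p w ≤ a * (1 + 1 / 50)} ∧
            (ShellCloseTo (1 / 5) T fccKissingPattern ∨ ShellCloseTo (1 / 5) T hcpKissingPattern)))) →
      ({w ∈ (Y : Set (EuclideanSpace ℝ (Fin 3))) | w ≠ y ∧ dist y w ≤ a * (1 + 1 / 50)}.ncard = 12 ∧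
            ∀ w ∈ (Y : Set (EuclideanSpace ℝ (Fin 3))), w ≠ y → a * (1 - 1 / 50) ≤ dist y w ∧
              (dist y w ≤ a * (1 + 1 / 50) ∨ a * (63 / 50) ≤ dist y w)) →
      (∃ T : Finset (EuclideanSpace ℝ (Fin 3)), (↑T : Set (EuclideanSpace ℝ (Fin 3))) =
              (fun w => a⁻¹ • (w - y)) '' {w ∈ (Y : Set (EuclideanSpace ℝ (Fin 3))) | w ≠ y ∧ dist y w ≤ a * (1 + 1 / 50)} ∧
            (ShellCloseTo (1 / 5) T fccKissingPattern ∨ ShellCloseTo (1 / 5) T hcpKissingPattern)))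
    (hRat : (∀ (Y : Set (EuclideanSpace ℝ (Fin 3))) (a : ℝ), 0 < a → Y.Nonempty →
          (∀ y ∈ Y, ({w ∈ Y | w ≠ y ∧ dist y w ≤ a * (1 + 1 / 50)}.ncard = 12 ∧
              ∀ w ∈ Y, w ≠ y → a * (1 - 1 / 50) ≤ dist y w ∧
                (dist y w ≤ a * (1 + 1 / 50) ∨ a * (63 / 50) ≤ dist y w))) →
          ∀ R : ℝ, ∃ c ∈ Y, ∀ y ∈ Y, dist y c ≤ R →
            (∃ T : Finset (EuclideanSpace ℝ (Fin 3)), (↑T : Set (EuclideanSpace ℝ (Fin 3))) =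
                (fun w => a⁻¹ • (w - y)) '' {w ∈ Y | w ≠ y ∧ dist y w ≤ a * (1 + 1 / 50)} ∧
              (ShellCloseTo (1 / 5) T fccKissingPattern ∨ ShellCloseTo (1 / 5) T hcpKissingPattern)))) :
    ∃ Y ∈ omegaLimit atTop
          (fun N (t : EuclideanSpace ℝ (Fin 3)) => (⟨Set.range (x N)⟩ : LocalConfig (EuclideanSpace ℝ (Fin 3))).translate t) Set.univ, (0 : EuclideanSpace ℝ (Fin 3)) ∈ Y ∧ ∀ y ∈ Y,
      (({w ∈ (Y : Set (EuclideanSpace ℝ (Fin 3))) | w ≠ y ∧ dist y w ≤ a * (1 + 1 / 50)}.ncard = 12 ∧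
            ∀ w ∈ (Y : Set (EuclideanSpace ℝ (Fin 3))), w ≠ y → a * (1 - 1 / 50) ≤ dist y w ∧
              (dist y w ≤ a * (1 + 1 / 50) ∨ a * (63 / 50) ≤ dist y w)) ∧
          (∃ T : Finset (EuclideanSpace ℝ (Fin 3)), (↑T : Set (EuclideanSpace ℝ (Fin 3))) =
              (fun w => a⁻¹ • (w - y)) '' {w ∈ (Y : Set (EuclideanSpace ℝ (Fin 3))) | w ≠ y ∧ dist y w ≤ a * (1 + 1 / 50)} ∧
            (ShellCloseTo (1 / 5) T fccKissingPattern ∨ ShellCloseTo (1 / 5) T hcpKissingPattern))) := by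
  sorry

/-- **Stub D — THE TRICHOTOMY FACTOR**: `ShellTrichotomy → TornFree → FiveFoldRationingR →`
pattern-typed rationing (an all-gapped-twelve non-empty `Y` has, for every `R`, a centre `c ∈ Y`
such that every site within `R` of `c` has a `1/5`-fcc/hcp-close rescaled shell).  TornFree gives
`≥ 4` common neighbours for every bond of the all-gapped `Y`, FiveFoldRationingR gives a centre `c`
with `≤ 4` for every bond within `R` of `c`; so every bond there has exactly four, every shell
there is admissible (all sites gapped), and the pointwise typing `cleR_fccHcpShell_of_exactFour`
applies. -/
theorem stub_cleRTrichotomyFactor (hST : ShellTrichotomy) (hTF : TornFree)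
    (hFFR : FiveFoldRationingR) : (∀ (Y : Set (EuclideanSpace ℝ (Fin 3))) (a : ℝ), 0 < a → Y.Nonempty →
          (∀ y ∈ Y, ({w ∈ Y | w ≠ y ∧ dist y w ≤ a * (1 + 1 / 50)}.ncard = 12 ∧
              ∀ w ∈ Y, w ≠ y → a * (1 - 1 / 50) ≤ dist y w ∧
                (dist y w ≤ a * (1 + 1 / 50) ∨ a * (63 / 50) ≤ dist y w))) →
          ∀ R : ℝ, ∃ c ∈ Y, ∀ y ∈ Y, dist y c ≤ R →
            (∃ T : Finset (EuclideanSpace ℝ (Fin 3)), (↑T : Set (EuclideanSpace ℝ (Fin 3))) =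
                (fun w => a⁻¹ • (w - y)) '' {w ∈ Y | w ≠ y ∧ dist y w ≤ a * (1 + 1 / 50)} ∧
              (ShellCloseTo (1 / 5) T fccKissingPattern ∨ ShellCloseTo (1 / 5) T hcpKissingPattern))) := by
  sorry

/-! ## Composition -/

/-- **`GappedShellCensus.CleanLimitExtractionR`** (item stmt-AtomisticToContinuum-18072, THE BRIDGE of
route `GappedShellCensus`): `RadialDefectsVanish → ShellTrichotomy → TornFree → FiveFoldRationingR →
CleanLocalLimit` — the rooted clean hull element (stub C₁) fed with ball counting (E), the two
closedness statements (A, B) and the trichotomy factor (D), read through the hull dictionary (C₂). -/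
theorem cleanLimitExtractionR_proof : CleanLimitExtractionR := by
  unfold CleanLimitExtractionR
  intro hRDV hST hTF hFFR x hx
  obtain ⟨a, ha1, ha2, hθ⟩ := hRDV x hx
  have ha : 0 < a := by linarith
  obtain ⟨Y, hY, h0, hclean⟩ := stub_cleRCleanHullElement x hx ha hθ
    (fun x δ hδ hsep good hbad k hk => stub_cleRGoodBall hδ hsep good hbad k hk)
    (fun S Y a δ ha hδ hS hY y r hy hyr hgood => stub_cleRGappedOfTendsto ha hδ hS hY hy hyr hgood)
    (fun S Y a δ ha hδ hS hY y r hy hyr hgood hGY =>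
      stub_cleRFccHcpOfTendsto ha hδ hS hY hy hyr hgood hGY)
    (stub_cleRTrichotomyFactor hST hTF hFFR)
  obtain ⟨φ, t, hφ, hmatch⟩ := stub_cleRHullDictionary hY
  exact ⟨(Y : Set (EuclideanSpace ℝ (Fin 3))), a, ha1, ha2, h0, ⟨φ, t, hφ, hmatch⟩, fun y hy => hclean y hy⟩

end Summit.AtomisticToContinuum.Crystallization.Theorems

end
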